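import Summits.Ventures.DiscreteObjects.Hadamard.ItoMatrix167Iff668

/-!
# Williamson sequences give an Ito-type quadruple (kernel remark linking the two gen-22 capstones; Horadam 2007 p. 64)

Framing: lottery ticket; floor = certified bounds/negative ranges.

Cell pub-namedobj (venture DiscreteObjects), target (H), hadamard gen 22.  For SYMMETRIC block sequences the twisted array
`[θ_W(g,h) · A_{g+h}(ε_g (t − s))]` of the Ito line coincides with the Williamson array `[θ_W(g,h) · A_{g+h}(t − s)]`
(`A(s − t) = A(t − s)`), so:
* `symmThetaWArray_eq_itoThetaWArray`: the two `Matrix.of` terms are equal for symmetric `A`;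
* **`williamsonSequences_imply_itoQuadruple`** (any `n`): Williamson sequences of length `n` ⇒ an Ito-type quadruple
  (`itoMatrix a b c d` Hadamard) — the classical inclusion 'Williamson matrices with symmetric circulant components are Ito
  type Q' (Horadam 2007 §2.3.2; Literature `ItoArray` docstring), REPLICATION in the kernel;
* **`hadamard668_normalizer_index_eight_implies_ito`**: at order 668, the left-hand side of capstone 1
  (`|N(⟨σ₁₆₇⟩) : ±⟨σ₁₆₇⟩| = 8`) implies the right-hand side of capstone 2 (an Ito-type quadruple of order 167), hence (by
  `hadamard668_ito_iff_itoMatrix`) an H(668) with the regular dihedral-type action.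
No new census content; H(668) untouched; HITS 0/4.  No `sorry`, no definitions, default heartbeats.
-/

namespace Summit.Ventures.DiscreteObjects.Hadamard

open Finset BigOperators Matrix

open Literature.Combinatorics.Designs.GoethalsSeidel (IsHadamardMatrix)
open Literature.Combinatorics.Designs.LegendrePairs (PAF IsPM)
open Literature.Combinatorics.Designs.ItoArray (itoMatrix)

section anyorder
variable {n : ℕ}

/-- for symmetric blocks the Williamson array and the Ito-type twisted array coincide -/
lemma symmThetaWArray_eq_itoThetaWArray (A : ZMod 2 × ZMod 2 → ZMod n → ℤ) (hsym : ∀ k r, A k (-r) = A k r) :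
    (Matrix.of fun (a b : (ZMod 2 × ZMod 2) × ZMod n) =>
        (if a.1 = 0 then (1 : ℤ) else if a.1 = (1, 0) then (if b.1.1 = 1 then 1 else -1)
          else if a.1 = (0, 1) then (if b.1.1 = b.1.2 then -1 else 1) else (if b.1.2 = 1 then 1 else -1)) *
        A (a.1 + b.1) (b.2 - a.2)) =
    Matrix.of fun (a b : (ZMod 2 × ZMod 2) × ZMod n) =>
        (if a.1 = 0 then (1 : ℤ) else if a.1 = (1, 0) then (if b.1.1 = 1 then 1 else -1)
          else if a.1 = (0, 1) then (if b.1.1 = b.1.2 then -1 else 1) else (if b.1.2 = 1 then 1 else -1)) *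
        A (a.1 + b.1) (if a.1.2 = 0 then b.2 - a.2 else a.2 - b.2) := by
  ext a b
  rw [Matrix.of_apply, Matrix.of_apply]
  by_cases h : a.1.2 = 0
  · rw [if_pos h]
  · rw [if_neg h, ← hsym (a.1 + b.1) (a.2 - b.2), neg_sub]

/-- **Williamson sequences ⇒ an Ito-type quadruple** (any length `n`). -/
theorem williamsonSequences_imply_itoQuadruple [NeZero n]
    (h : ∃ a b c d : ZMod n → ℤ, IsPM a ∧ IsPM b ∧ IsPM c ∧ IsPM d ∧ (∀ i, a (-i) = a i) ∧ (∀ i, b (-i) = b i) ∧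
      (∀ i, c (-i) = c i) ∧ (∀ i, d (-i) = d i) ∧ ∀ s : ZMod n, s ≠ 0 → PAF a s + PAF b s + PAF c s + PAF d s = 0) :
    ∃ a b c d : ZMod n → ℤ, IsHadamardMatrix (itoMatrix a b c d) := by
  obtain ⟨A, hsym, hW⟩ := symmThetaWArray_iff_williamsonSequences.mpr h
  rw [symmThetaWArray_eq_itoThetaWArray A hsym] at hW
  exact itoThetaWArray_iff_itoMatrix.mp ⟨A, hW⟩

end anyorder

/-- **At order 668: maximal 167-local symmetry (capstone 1) ⇒ an Ito-type quadruple of order 167 (capstone 2's right-hand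
side).** -/
theorem hadamard668_normalizer_index_eight_implies_ito
    (h : ∃ (ι : Type) (_ : Fintype ι) (_ : DecidableEq ι) (H : Matrix ι ι ℤ) (π κ π₁ κ₁ π₂ κ₂ π' κ' : Equiv.Perm ι)
        (d e d₁ e₁ d₂ e₂ d' e' : ι → ℤ) (μ : ℕ), Fintype.card ι = 668 ∧ IsHadamardMatrix H ∧ IsSignedAut H π κ d e ∧
        π ^ 167 = 1 ∧ κ ^ 167 = 1 ∧ (π ≠ 1 ∨ κ ≠ 1) ∧ IsSignedAut H π₁ κ₁ d₁ e₁ ∧ IsSignedAut H π₂ κ₂ d₂ e₂ ∧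
        Commute π₁ π ∧ Commute κ₁ κ ∧ Commute π₂ π ∧ Commute κ₂ κ ∧ π₁ ^ 2 = 1 ∧ κ₁ ^ 2 = 1 ∧ π₂ ^ 2 = 1 ∧ κ₂ ^ 2 = 1 ∧
        (π₁ ≠ 1 ∨ κ₁ ≠ 1) ∧ (π₂ ≠ 1 ∨ κ₂ ≠ 1) ∧ (π₁ ≠ π₂ ∨ κ₁ ≠ κ₂) ∧ IsSignedAut H π' κ' d' e' ∧
        π' * π = π ^ μ * π' ∧ κ' * κ = κ ^ μ * κ' ∧ μ % 167 = 166) :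
    ∃ a b c d : ZMod 167 → ℤ, IsHadamardMatrix (itoMatrix a b c d) :=
  williamsonSequences_imply_itoQuadruple (hadamard668_normalizer_index_eight_iff_williamsonSequences.mp h)

end Summit.Ventures.DiscreteObjects.Hadamard
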